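import Summits.Ventures.PercRepro.RankLevelSetDepCountGen
import Summits.Ventures.PercRepro.RankLevelSetLevelFive
import Summits.Ventures.PercRepro.RankLevelSetDepCountSplit
import Summits.Ventures.PercRepro.RankLevelSetLevelFiveArithSplitC
import Summits.Ventures.PercRepro.RankLevelSetLevelFourSplit
import Summits.Ventures.PercRepro.RankLevelSetTriangleStar
import Summits.Ventures.PercRepro.RankLevelSetPlaneTen
import Summits.Ventures.PercRepro.RankLevelSetCoreFour
import Summits.Ventures.PercRepro.RankLevelSetFrameLarge
import Summits.Ventures.PercRepro.RankLevelSetFrameQM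

/-!
# PercRepro — THEOREM C₅, SPLIT COUNT: C-025 AT LEVEL `5` FOR EVERY FINITE MATROID AND EVERY `p ≥ 175`, GIVEN LEVEL `4`
(night-1, gen 4)

`proofs/NIGHT-1-C025-induction.md` §15.15. The level-`5` assembly with the SPLIT fibre count
`ncard_eRk_eq_ncard_le_le_split` (RankLevelSetDepCountSplit: pairs with a small closure charged `σ_small`, pairs with a big
closure confined to the union of the short circuits, `|S₀| ≤ 6d`), `s₃ ≤ d²`, and the polynomial inequalities
`level_five_poly_split` (`p ≥ 174`): `c025_core_five_bounded_corank_split`, `c025_five_of_four_split`.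
Axioms: standard.
-/

open scoped Matroid

namespace PercRepro

namespace ThmN

open Set

variable {α : Type}

/-- **The `e`-free core at level `5`, corank `6 ≤ d ≤ 27`, rank `p ≥ 174`** (split count, `s₃ ≤ d²`). -/
theorem c025_core_five_bounded_corank_split (M : Matroid α) [M.Finite] (p d : ℕ) (hp : 174 ≤ p) (hd6 : 6 ≤ d)
    (hd27 : d ≤ 27) (hR : M.eRank = (p : ℕ∞)) (hn : M.E.ncard = p + d)
    (hfree : ∀ e ∈ M.E, ∃ A ⊆ M.E \ {e}, e ∉ M.closure A ∧ e ∉ M.closure ((M.E \ {e}) \ A)) :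
    RLS M p 5 := by
  classical
  have hEcard : M.ground_finite.toFinset.card = p + d := by
    rw [← Set.ncard_eq_toFinset_card _ M.ground_finite]; exact hn
  -- the core is simple: every circuit has `≥ 3` elements
  have hL : ∀ e ∈ M.E, ¬ M.IsLoop e := not_isLoop_of_free M hfree
  have hs : ∀ e ∈ M.E, ∀ f ∈ M.E, e ≠ f → M.eRk {e, f} = 2 := by
    intro e he f hf hef
    have h2 : (2 : ℕ∞) ≤ M.eRk {e, f} :=
      two_le_eRk_of_two_le_ncard_of_free M hfree (pair_subset he hf) (by rw [ncard_pair hef])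
    have h3 : M.eRk {e, f} ≤ 2 := by
      have := M.eRk_le_encard {e, f}
      rwa [encard_pair hef] at this
    exact le_antisymm h3 h2
  have hcirc : ∀ C, M.IsCircuit C → 3 ≤ C.encard := three_le_encard_of_circuit M hL hs
  -- rank-`≤ 5` sets have `≤ 21` points
  have hflat : ∀ X ⊆ M.E, M.eRk X ≤ 5 → X.ncard ≤ 21 :=
    fun X hX hr => ncard_le_twentyone_of_eRk_le_five_of_free M hfree hX hr
  have hd : M.E.encard = M.eRank + d := by
    rw [hR, ← M.ground_finite.cast_ncard_eq, hn]
    push_cast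
    ring
  -- (U)
  have hflat' : ∀ X ⊆ M.E, M.eRk X ≤ ((5 - 1 : ℕ) : ℕ∞) → X.ncard ≤ 10 :=
    fun X hX hr => ncard_le_ten_of_eRk_le_four_of_free M hfree hX (by simpa using hr)
  have hU1 := Matroid.topCount_le_ncard_compl (M := M) hR hd 5
  have hU2 := Matroid.ncard_eRk_eq_ncard_le_le_split M 5 21 10 (by norm_num) hcirc hflat hflat' hd
  rw [hn, sum_Icc_three_six, sum_Icc_three_six] at hU2
  simp only [show (5 : ℕ) + 1 - 3 = 3 from rfl, show (5 : ℕ) + 1 - 4 = 2 from rfl,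
    show (5 : ℕ) + 1 - 5 = 1 from rfl, show (5 : ℕ) + 1 - 6 = 0 from rfl, Nat.choose_one_right,
    Nat.choose_zero_right, mul_one, show (21 : ℕ) - (5 + 1) = 15 from rfl, show (10 : ℕ) - 5 = 5 from rfl,
    show (5 : ℕ) + 1 = 6 from rfl] at hU2
  have hC1 : ∀ L ⊆ M.E, M.eRk L = 2 → L.ncard ≤ 3 :=
    fun L hL hr => ncard_le_three_of_eRk_two M hs hfree hL hr
  have hs3 : {C | M.IsCircuit C ∧ C.ncard = 3}.ncard ≤ d * d := ncard_triangles_le_sq M hC1 hd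
  have hs4 : {C | M.IsCircuit C ∧ C.ncard = 4}.ncard ≤ (d + 3).choose 4 :=
    Matroid.ncard_circuits_le_choose_of_encard M hd 3
  have hs5 : {C | M.IsCircuit C ∧ C.ncard = 5}.ncard ≤ (d + 4).choose 5 :=
    Matroid.ncard_circuits_le_choose_of_encard M hd 4
  have hs6 : {C | M.IsCircuit C ∧ C.ncard = 6}.ncard ≤ (d + 5).choose 6 :=
    Matroid.ncard_circuits_le_choose_of_encard M hd 5
  have hU : Matroid.topCount M p 5 ≤ (p + d).choose 5 +
      (∑ j ∈ Finset.range (d - 6 + 1), Nat.choose 5 j) *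
        (d * d * (p + d).choose 3 + (d + 3).choose 4 * (p + d).choose 2 +
          (d + 4).choose 5 * (p + d) + (d + 5).choose 6) +
      (∑ j ∈ Finset.range (d - 6 + 1), Nat.choose 15 j) *
        (d * d * (6 * d).choose 3 + (d + 3).choose 4 * (6 * d).choose 2 +
          (d + 4).choose 5 * (6 * d) + (d + 5).choose 6) := by
    refine hU1.trans (hU2.trans ?_)
    gcongr
  -- (Y)
  have hY := Matroid.two_pow_le_midCount_add (M := M) p 5 hR
  have hA : {X : Set α | X ⊆ M.E ∧ M.eRk X ≤ 5}.ncard ≤ ∑ j ∈ Finset.range (21 + 1), (p + d).choose j := by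
    calc {X : Set α | X ⊆ M.E ∧ M.eRk X ≤ 5}.ncard
        ≤ {X : Set α | X ⊆ (M.ground_finite.toFinset : Set α) ∧ X.ncard ≤ 21}.ncard := by
          apply ncard_le_ncard
          · intro X hX
            exact ⟨by rw [Set.Finite.coe_toFinset]; exact hX.1, hflat X hX.1 hX.2⟩
          · exact (Finset.finite_toSet _).finite_subsets.subset (fun X hX => hX.1)
      _ ≤ ∑ j ∈ Finset.range (21 + 1), M.ground_finite.toFinset.card.choose j :=
          ncard_subsets_ncard_le _ 21
      _ = ∑ j ∈ Finset.range (21 + 1), (p + d).choose j := by rw [hEcard]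
  have hB := Matroid.ncard_spanning_le (M := M) hd
  rw [hEcard] at hY hB
  -- the tails
  have hT : 16 * ∑ j ∈ Finset.range 28, (p + d).choose j ≤ 2 ^ (p + d) :=
    sixteen_mul_sum_choose_le_twentyseven (p + d) (by omega)
  have hA' : ∑ j ∈ Finset.range (21 + 1), (p + d).choose j ≤ ∑ j ∈ Finset.range 28, (p + d).choose j :=
    Finset.sum_le_sum_of_subset_of_nonneg (Finset.range_mono (by norm_num)) (fun _ _ _ => Nat.zero_le _)
  have hB' : ∑ j ∈ Finset.range (d + 1), (p + d).choose j ≤ ∑ j ∈ Finset.range 28, (p + d).choose j :=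
    Finset.sum_le_sum_of_subset_of_nonneg (Finset.range_mono (by omega)) (fun _ _ _ => Nat.zero_le _)
  have hAB : 8 * ({X : Set α | X ⊆ M.E ∧ M.eRk X ≤ 5}.ncard +
      {X : Set α | X ⊆ M.E ∧ M.eRk X = M.eRank}.ncard) ≤ 2 ^ (p + d) := by
    have h1 := hA.trans hA'
    have h2 := hB.trans hB'
    omega
  -- (Φ) and the polynomial inequality
  have hΦ := phiK_le_two_pow_div p 5
  rw [Nat.choose_symm_add] at hΦ
  have hpoly := level_five_poly_split d hd6 hd27 p hp
  rw [add_assoc] at hU hpoly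
  -- assemble in `ℚ`
  rw [RLS_iff]
  have hUq : (Matroid.topCount M p 5 : ℚ) ≤ ((p + d).choose 5 : ℚ) +
      (((∑ j ∈ Finset.range (d - 6 + 1), Nat.choose 5 j) *
        (d * d * (p + d).choose 3 + (d + 3).choose 4 * (p + d).choose 2 +
          (d + 4).choose 5 * (p + d) + (d + 5).choose 6) +
      (∑ j ∈ Finset.range (d - 6 + 1), Nat.choose 15 j) *
        (d * d * (6 * d).choose 3 + (d + 3).choose 4 * (6 * d).choose 2 +
          (d + 4).choose 5 * (6 * d) + (d + 5).choose 6) : ℕ) : ℚ) := by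
    exact_mod_cast hU
  have hYq : (2 : ℚ) ^ (p + d) ≤ (Matroid.midCount M p 5 : ℚ) +
      ({X : Set α | X ⊆ M.E ∧ M.eRk X ≤ 5}.ncard : ℚ) +
      ({X : Set α | X ⊆ M.E ∧ M.eRk X = M.eRank}.ncard : ℚ) := by exact_mod_cast hY
  have hABq : 8 * (({X : Set α | X ⊆ M.E ∧ M.eRk X ≤ 5}.ncard : ℚ) +
      ({X : Set α | X ⊆ M.E ∧ M.eRk X = M.eRank}.ncard : ℚ)) ≤ 2 ^ (p + d) := by exact_mod_cast hAB
  have hpolyq : 8 * (((p + d).choose 5 : ℚ) +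
      (((∑ j ∈ Finset.range (d - 6 + 1), Nat.choose 5 j) *
        (d * d * (p + d).choose 3 + (d + 3).choose 4 * (p + d).choose 2 +
          (d + 4).choose 5 * (p + d) + (d + 5).choose 6) +
      (∑ j ∈ Finset.range (d - 6 + 1), Nat.choose 15 j) *
        (d * d * (6 * d).choose 3 + (d + 3).choose 4 * (6 * d).choose 2 +
          (d + 4).choose 5 * (6 * d) + (d + 5).choose 6) : ℕ) : ℚ)) ≤
      7 * 2 ^ (d - 5) * ((p + 5).choose 5 : ℚ) := by exact_mod_cast hpoly
  have hU0 : (0 : ℚ) ≤ (Matroid.topCount M p 5 : ℚ) := Nat.cast_nonneg _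
  have hd5 : 5 ≤ d := by omega
  exact level_arith (p := p) (d := d) (n := p + d) (q := 5) rfl hd5 hΦ hU0 hUq hYq hABq hpolyq

/-- **THEOREM C₅, SPLIT COUNT, GIVEN LEVEL `4`**: level `4` for all `p ≥ 43` implies level `5` for all `p ≥ 175`. -/
theorem c025_five_of_four_split (h4 : ∀ (M : Matroid α) [M.Finite] (p : ℕ), 43 ≤ p → RLS M p 4) :
    ∀ (M : Matroid α) [M.Finite] (p : ℕ), 175 ≤ p → RLS M p 5 := by
  intro M _ p hp
  refine rls_succ_large (α := α) 4 5 174 ?_ ?_ ?_ M p hp (by omega)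
  · -- level `4` for `p ≥ 834`
    intro M' _ p' hP _
    exact h4 M' p' (by omega)
  · -- corank `≤ 5`: `U = ∅` or Theorem M
    intro M' _ p' _ hn _
    rcases Nat.lt_or_ge M'.E.ncard (p' + 5) with h | h
    · exact RLS_of_ncard_lt M' h
    · exact RLS_of_ncard_eq M' (by omega)
  · -- the core: coranks `6 … 27` by counting, coranks `≥ 28` by `c025_core_five_twentyone`
    intro M' _ p' hP hR hbig _ hfree
    rcases Nat.lt_or_ge M'.E.ncard (p' + 28) with h | h
    · exact c025_core_five_bounded_corank_split M' p' (M'.E.ncard - p') hP (by omega) (by omega) hR (by omega) hfree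
    · exact c025_core_five_twentyone M' p' (by omega) hR (by omega) hfree

/-- **THEOREM C₅, SPLIT COUNT, GIVEN LEVEL `3`**: level `3` for all `p ≥ 5` implies level `5` for all `p ≥ 175`. -/
theorem c025_five_of_three_split (h3 : ∀ (M : Matroid α) [M.Finite] (p : ℕ), 5 ≤ p → RLS M p 3) :
    ∀ (M : Matroid α) [M.Finite] (p : ℕ), 175 ≤ p → RLS M p 5 :=
  c025_five_of_four_split (c025_four_of_three_split h3)

end ThmN

end PercRepro
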